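import Summits.Ventures.CertifiedArithmetic.LowPrec.MX
import Mathlib.Data.Int.Log

/-!
# Conversion of a vector to an MX block (OCP MX "Algorithm 1") and its range facts

HONEST FRAMING (venture CertifiedArithmetic / cell `pub-lowprec`): certified error envelopes and
provably optimal rounding/accumulation schemes for low-precision formats under stated cost models;
every table by two implementations; no hardware or vendor claims.

The working conversion recipe of [RouhaniEtAl2023MX, §3, Algorithm 1] (following OCP MX v1.0 §6.3):
for a block `V₁ … V_k` of rationals and an element format `φ`,
`shared_exp = ⌊log₂(maxᵢ |Vᵢ|)⌋ - emax_elem`, `X = 2^shared_exp`,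
`Pᵢ = quantize(Vᵢ / X)` "clamping normal numbers" — here `quantize = roundNE φ` (RNE,
saturating, = clamping) and `emax_elem = emaxCode - bias` (exponent of the largest normal binade).
Proved: with `M = maxᵢ |Vᵢ| > 0`, the scaled block maximum lands in the TOP binade,
`2^emax_elem ≤ M / X < 2^(emax_elem + 1)` (`scaled_blockMax_mem_top_binade`), every scaled element
satisfies `|Vᵢ| / X < 2^(emax_elem+1)` (`scaled_lt_pow`), and `maxRat φ < 2^(emax_elem+1)`
(`maxRat_lt_pow_emaxElem`); hence an element is CLAMPED exactly when `maxRat < |Vᵢ|/X`, which can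
only happen in the top binade, with quantization error `|Vᵢ|/X - maxRat < 2^(emax_elem+1) - maxRat`
(`clamp_error_lt`) — for `E4M3` (truncated top binade) that is the window `(448, 512)·X` with
error up to `64·X`; for full-top-binade formats (`E5M2`, FP6, FP4) it is the half-ulp-wide sliver
above `maxRat`. In range the usual RNE envelopes of `Round.lean` apply to `Vᵢ/X`.
`E8M0` range: `shared_exp` is stored clamped to `[-127, 127]`; the theorems about `X` are stated
for the unclamped exponent (hypothesis-free) and the stored block equals it when in range.
-/

namespace Literature.ComputerArithmetic.FloatingPoint

open Finset

namespace Format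

/-- `emax_elem`: exponent of the largest normal binade of `φ` (`emaxCode - bias`; E4M3: 8,
E5M2: 15, E3M2: 4, E2M3: 2, E2M1: 2). [cite: RouhaniEtAl2023MX, §3 Algorithm 1] -/
def emaxElem (φ : Format) : ℤ := (φ.emaxCode : ℤ) - φ.bias

/-- The named formats' `emax_elem`. [cite: RouhaniEtAl2023MX, §3] -/
theorem emaxElem_values : E4M3.emaxElem = 8 ∧ E5M2.emaxElem = 15 ∧ E3M2.emaxElem = 4 ∧
    E2M3.emaxElem = 2 ∧ E2M1.emaxElem = 2 := by decide

/-- `maxRat < 2^(emax_elem + 1)`: the largest finite value lies in the top binade. [folklore] -/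
theorem maxRat_lt_pow_emaxElem (φ : Format) (h : 1 ≤ φ.emaxCode) :
    φ.maxRat < (2 : ℚ) ^ (φ.emaxElem + 1) := by
  unfold maxRat quantum emaxElem qexp
  have hlt := maxScaled_lt_pow (φ := φ) h
  have h2 : (2 : ℚ) ≠ 0 := by norm_num
  have : (φ.maxScaled : ℚ) < (2 : ℚ) ^ ((φ.manBits + φ.emaxCode : ℕ) : ℤ) := by
    rw [zpow_natCast]; exact_mod_cast hlt
  calc (φ.maxScaled : ℚ) * 2 ^ (1 - (φ.bias : ℤ) - φ.manBits)
      < (2 : ℚ) ^ ((φ.manBits + φ.emaxCode : ℕ) : ℤ) * 2 ^ (1 - (φ.bias : ℤ) - φ.manBits) :=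
        mul_lt_mul_of_pos_right this (zpow_pos (by norm_num) _)
    _ = (2 : ℚ) ^ ((φ.emaxCode : ℤ) - φ.bias + 1) := by
        rw [← zpow_add₀ h2]; congr 1; push_cast; ring

/-- `2^emax_elem ≤ maxRat` (there is a normal binade at the top). [folklore] -/
theorem pow_emaxElem_le_maxRat (φ : Format) (h : 1 ≤ φ.emaxCode) :
    (2 : ℚ) ^ φ.emaxElem ≤ φ.maxRat := by
  unfold maxRat quantum emaxElem qexp maxScaled scaled
  rw [if_neg (by omega)]
  have h2 : (2 : ℚ) ≠ 0 := by norm_num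
  have : (2 : ℚ) ^ ((φ.manBits + (φ.emaxCode - 1) : ℕ) : ℤ)
      ≤ (((2 ^ φ.manBits + φ.topMan) * 2 ^ (φ.emaxCode - 1) : ℕ) : ℚ) := by
    rw [zpow_natCast]; push_cast
    rw [pow_add]
    exact mul_le_mul_of_nonneg_right (by linarith [(Nat.cast_nonneg φ.topMan : (0:ℚ) ≤ φ.topMan)])
      (by positivity)
  calc (2 : ℚ) ^ ((φ.emaxCode : ℤ) - φ.bias)
      = (2 : ℚ) ^ ((φ.manBits + (φ.emaxCode - 1) : ℕ) : ℤ) * 2 ^ (1 - (φ.bias : ℤ) - φ.manBits) := by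
        rw [← zpow_add₀ h2]; congr 1; push_cast [Nat.cast_sub h]; ring
    _ ≤ _ := mul_le_mul_of_nonneg_right this (zpow_pos (by norm_num) _).le

end Format

namespace MXBlock

variable {φ : Format} {k : ℕ}

/-- Block maximum `maxᵢ |Vᵢ|` (`0` for the empty block). [cite: RouhaniEtAl2023MX, §3 Algorithm 1] -/
def blockMax (V : Fin k → ℚ) : ℚ := Finset.univ.fold max 0 fun i => |V i|

/-- Every element is bounded by the block maximum. [folklore] -/
theorem abs_le_blockMax (V : Fin k → ℚ) (i : Fin k) : |V i| ≤ blockMax V := by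
  unfold blockMax
  exact (Finset.le_fold_max (f := fun i => |V i|) _).mpr (Or.inr ⟨i, Finset.mem_univ _, le_rfl⟩)

/-- The block maximum is nonnegative. [folklore] -/
theorem blockMax_nonneg (V : Fin k → ℚ) : 0 ≤ blockMax V := by
  unfold blockMax
  exact (Finset.le_fold_max (f := fun i => |V i|) _).mpr (Or.inl le_rfl)

/-- Algorithm 1, line 1: `shared_exp = ⌊log₂ (maxᵢ |Vᵢ|)⌋ - emax_elem` (for the all-zero block
`Int.log 2 0 = 0` by convention, documented junk value). [cite: RouhaniEtAl2023MX, §3 Algorithm 1] -/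
def sharedExp (φ : Format) (V : Fin k → ℚ) : ℤ := Int.log 2 (blockMax V) - φ.emaxElem

/-- Algorithm 1, line 2: the shared scale `X = 2^shared_exp` (unclamped). [cite: RouhaniEtAl2023MX, §3 Algorithm 1] -/
def scaleRat (φ : Format) (V : Fin k → ℚ) : ℚ := (2 : ℚ) ^ sharedExp φ V

/-- The scale is positive. [folklore] -/
theorem scaleRat_pos (φ : Format) (V : Fin k → ℚ) : 0 < scaleRat φ V := zpow_pos (by norm_num) _

/-- Algorithm 1, lines 3–5 with the `E8M0` storage: the MX block with scale code
`clamp (shared_exp + 127) 0 254` and elements `Pᵢ = roundNE φ (Vᵢ / X)` (RNE, clamping at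
`±max`). [cite: RouhaniEtAl2023MX, §3 Algorithm 1] -/
def quantize (φ : Format) (V : Fin k → ℚ) : MXBlock φ k where
  scale := ⟨(min (max (sharedExp φ V + 127) 0) 254).toNat, by omega⟩
  elem i := roundNE φ (V i / scaleRat φ V)

/-- When `shared_exp ∈ [-127, 127]` the stored `E8M0` scale is exactly `X = 2^shared_exp`.
[cite: RouhaniEtAl2023MX, §2.2] -/
theorem scale_toRat_quantize (φ : Format) (V : Fin k → ℚ) (hlo : -127 ≤ sharedExp φ V)
    (hhi : sharedExp φ V ≤ 127) : (quantize φ V).scale.toRat = scaleRat φ V := by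
  unfold quantize E8M0.toRat scaleRat
  simp only
  congr 1
  have : (min (max (sharedExp φ V + 127) 0) 254) = sharedExp φ V + 127 := by omega
  rw [this]; omega

/-- THE BLOCK MAXIMUM LANDS IN THE TOP BINADE: for a nonzero block,
`2^emax_elem ≤ (maxᵢ |Vᵢ|) / X < 2^(emax_elem + 1)`. [cite: RouhaniEtAl2023MX, §3] -/
theorem scaled_blockMax_mem_top_binade (φ : Format) (V : Fin k → ℚ) (hM : 0 < blockMax V) :
    (2 : ℚ) ^ φ.emaxElem ≤ blockMax V / scaleRat φ V ∧
      blockMax V / scaleRat φ V < (2 : ℚ) ^ (φ.emaxElem + 1) := by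
  have h2 : (2 : ℚ) ≠ 0 := by norm_num
  have hX := scaleRat_pos φ V
  have hlow : ((2 : ℕ) : ℚ) ^ Int.log 2 (blockMax V) ≤ blockMax V := Int.zpow_log_le_self (by norm_num) hM
  have hup : blockMax V < ((2 : ℕ) : ℚ) ^ (Int.log 2 (blockMax V) + 1) := Int.lt_zpow_succ_log_self (by norm_num) _
  push_cast at hlow hup
  have hXe : scaleRat φ V = (2 : ℚ) ^ (Int.log 2 (blockMax V) - φ.emaxElem) := rfl
  constructor
  · rw [le_div_iff₀ hX, hXe, ← zpow_add₀ h2]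
    have : φ.emaxElem + (Int.log 2 (blockMax V) - φ.emaxElem) = Int.log 2 (blockMax V) := by ring
    rw [this]; exact hlow
  · rw [div_lt_iff₀ hX, hXe, ← zpow_add₀ h2]
    have : φ.emaxElem + 1 + (Int.log 2 (blockMax V) - φ.emaxElem) = Int.log 2 (blockMax V) + 1 := by ring
    rw [this]; exact hup

/-- Every scaled element is below `2^(emax_elem + 1)`. [folklore] -/
theorem scaled_lt_pow (φ : Format) (V : Fin k → ℚ) (hM : 0 < blockMax V) (i : Fin k) :
    |V i| / scaleRat φ V < (2 : ℚ) ^ (φ.emaxElem + 1) :=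
  lt_of_le_of_lt (div_le_div_of_nonneg_right (abs_le_blockMax V i) (scaleRat_pos φ V).le)
    (scaled_blockMax_mem_top_binade φ V hM).2

/-- CLAMPING WINDOW: a scaled element exceeding `maxRat` (hence clamped by `roundNE`) does so by
less than `2^(emax_elem+1) - maxRat`; its quantization error is `|Vᵢ|/X - maxRat` in that window
(the value delivered has magnitude exactly `maxRat`). [folklore] -/
theorem clamp_error_lt (φ : Format) (V : Fin k → ℚ) (hM : 0 < blockMax V)
    (i : Fin k) (hclamp : φ.maxRat < |V i| / scaleRat φ V) :
    |((quantize φ V).elem i).toRat| = φ.maxRat ∧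
      |V i| / scaleRat φ V - φ.maxRat < (2 : ℚ) ^ (φ.emaxElem + 1) - φ.maxRat := by
  refine ⟨?_, by linarith [scaled_lt_pow φ V hM i]⟩
  unfold quantize; simp only
  apply MiniFloat.abs_toRat_roundNE_of_maxRat_le
  rw [abs_div, abs_of_pos (scaleRat_pos φ V)]; exact hclamp.le

/-- IN-RANGE ELEMENTS obey the RNE standard model after scaling: if `|Vᵢ|/X ≤ maxRat` then
`|Vᵢ/X - Pᵢ| ≤ max (u·|Vᵢ/X|) (quantum/2)`. [folklore] -/
theorem quantize_error_le (φ : Format) (V : Fin k → ℚ) (i : Fin k)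
    (h : |V i| / scaleRat φ V ≤ φ.maxRat) :
    |V i / scaleRat φ V - ((quantize φ V).elem i).toRat|
      ≤ max (φ.unitRoundoff * |V i / scaleRat φ V|) (φ.quantum / 2) := by
  unfold quantize; simp only
  apply MiniFloat.abs_sub_roundNE_le_max
  rw [abs_div, abs_of_pos (scaleRat_pos φ V)]; exact h

/-- `E4M3` clamping window in numbers: `2^(8+1) - 448 = 64`, i.e. scaled elements in `(448, 512)`
are delivered as `448` (error `< 64`, relative `< 1/8`); for `E5M2` the window is
`(57344, 65536)`, width `8192 = ulp/1`... i.e. `2^16 - 57344 = 8192`. [folklore] -/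
theorem clamp_window_values :
    (2 : ℚ) ^ (Format.E4M3.emaxElem + 1) - Format.E4M3.maxRat = 64 ∧
    (2 : ℚ) ^ (Format.E5M2.emaxElem + 1) - Format.E5M2.maxRat = 8192 ∧
    (2 : ℚ) ^ (Format.E2M1.emaxElem + 1) - Format.E2M1.maxRat = 2 := by
  decide +kernel

end MXBlock

end Literature.ComputerArithmetic.FloatingPoint
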